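import Literature.MathematicalPhysics.QuantumFieldTheory.ConformalBootstrap3D.PointKernelK34v2Data
import Literature.MathematicalPhysics.QuantumFieldTheory.ConformalBootstrap3D.PointKernelParts

/-!
# K34v2 certificate, kernel part file P51: one-cell head segments 156, 157 in level ranges

The head cells whose kernel evaluation exceeds one `decide` are one-cell segments of `hsegsK34v2`; each is
checked by `PCert.hPartSideOK` (side conditions) and `PCert.hPartOK` per level range `[n_lo, n_lo + count)`
against an integer claim, the claims summing to `≥ 0` (`PointKernel.partsOK`); soundness is
`PCert.hParts_sound` (`PointKernelParts`).  The part files `P1, P2, …` are mutually independent (each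
imports only the data file); the ranges of one cell may span several of them, and the per-cell
conclusions `hparts_i` / `hcell_i` of those cells are assembled in `PointKernelK34v2.lean`.
Estimated kernel time 236 s.
-/

set_option maxRecDepth 100000
set_option maxHeartbeats 0

namespace Literature.MathematicalPhysics.QuantumFieldTheory.ConformalBootstrap3D.PointKernelK34v2

open Literature.MathematicalPhysics.QuantumFieldTheory.ConformalBootstrap3D.PointKernel

/-- levels `[56, 61)` of segment 156: partial lower sum `≥` claim. [folklore] -/
theorem part_156_4 : certK34v2.hPartOK (PCert.segAt hsegsK34v2 156) JHK34v2 56 5 (633986962970994417440246932072321758) = true := by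
  decide +kernel

/-- levels `[61, 65)` of segment 156: partial lower sum `≥` claim. [folklore] -/
theorem part_156_5 : certK34v2.hPartOK (PCert.segAt hsegsK34v2 156) JHK34v2 61 4 (235518681669001954956219749041891882) = true := by
  decide +kernel

/-- one-cell segment 157 (row 6, cell `[3589/512, 7179/1024]`, chord, `n_F = 56`,
4 level ranges): side conditions. [folklore] -/
theorem pside_157 : certK34v2.hPartSideOK (PCert.segAt hsegsK34v2 157) JHK34v2 = true := by
  decide +kernel

/-- its level ranges `(n_lo, count, claim)`. [folklore] -/
def parts_157 : List (ℕ × ℕ × ℤ) := [(0, 30, -26781357661412097450773680962751396035), (30, 13, 20894528175425780469800687958304676432), (43, 9, 4721417884955727119932016277297918791), (52, 5, 1165411601030589861040976727148800812)]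

/-- the ranges tile `[0, n_F]` and the claims sum to `≥ 0`. [folklore] -/
theorem pcov_157 : PointKernel.partsOK 56 parts_157 = true := by
  decide +kernel

/-- levels `[0, 30)` of segment 157: partial lower sum `≥` claim. [folklore] -/
theorem part_157_0 : certK34v2.hPartOK (PCert.segAt hsegsK34v2 157) JHK34v2 0 30 (-26781357661412097450773680962751396035) = true := by
  decide +kernel

/-- levels `[30, 43)` of segment 157: partial lower sum `≥` claim. [folklore] -/
theorem part_157_1 : certK34v2.hPartOK (PCert.segAt hsegsK34v2 157) JHK34v2 30 13 (20894528175425780469800687958304676432) = true := by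
  decide +kernel

end Literature.MathematicalPhysics.QuantumFieldTheory.ConformalBootstrap3D.PointKernelK34v2
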